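import Summits.CriticalPhenomena.SAWScalingLimit.Theses.SAWDevelopingMap
import Summits.CriticalPhenomena.SAWScalingLimit.Theses.SAWCompassLattice
import Literature.Probability.RandomPlanarGeometry.SLEUniquenessInLaw
import Literature.Probability.RandomPlanarGeometry.SAWScalingLimitFamily
import Literature.Probability.RandomPlanarGeometry.YangBaxterSAWLaw
import Literature.Probability.RandomPlanarGeometry.ZoomFlow

/-!
# Line `pin-the-shear`, stub 1 (`stub_ybShearTransport`) is implied by `YBSquareSLE` (stmt-6967), with `Φ = id`

Crux stmt-CriticalPhenomena-14221 `HexTransfer`, line `pin-the-shear` (`Cruxes/HexTransfer/Lines/pin_the_shear.lean`).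
The statement of the line's hardest stub `stub_ybShearTransport` — law-level Yang–Baxter transport of the
critical hexagonal SAW law to Glazman–Manolescu's `Θ ≡ π/2` walk, modulo an unidentified linear `Φ ∈ GL₂⁺`,
under (A) = `HexConjecture` — is implied, WITH THE IDENTITY MATRIX, by the open crux
`SAWCompassLattice.YBSquareSLE` (stmt-6967) together with the existence of hexagonal endpoint approximations
(written out; = `SAWResidueField.HexEndpointApproxExists`, item 9864 — a theorem of the tree:
`Sandwich.hexEndpointApproxExists`, `Theorems/SAWPhaseRetrievalHexTransferOfLatticeUniversality.lean`, p106915;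
kept as an explicit, spelled-out hypothesis here only so that this file imports no route file beyond the two
whose declarations the statement mentions): under (A) and `YBSquareSLE` both laws converge to chordal SLE(8/3) random curves of the same
Dobrushin domain, which are equal in law (`IsSLECurve.map_eq_holds`), so their integrals against a bounded
continuous test function have the same limit. Hence the open content of stub 1 is AT MOST stmt-6967;
conversely stub 1 is the GL₂⁺-tolerant weakening of it that the line's landed pin affords
(`stub_pinLineReduction`, p103231). Argument of the second seat c1
(`Cruxes/HexTransfer/Lines/pin_the_shear_c1_reduction.lean`), landed by the third seat c2 as the registered
stub `ybShearTransport_of_ybSquareSLE` (namespace `…Sandwich`, next to `hexTransfer_of_latticeUniversality`).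
-/

noncomputable section

namespace Summit.CriticalPhenomena.SAWScalingLimit.Cruxes.HexTransfer.Sandwich

open MeasureTheory Filter Topology Set
open scoped NNReal ENNReal
open Literature.Probability.RandomPlanarGeometry
open Literature.Probability.RandomPlanarGeometry.SAW.YangBaxter
open Literature.Probability.LatticeModels (Site HexVertex hexGraph hexCenter)
open Summit.CriticalPhenomena.SAWScalingLimit.Theses

/-- **Stub 1 from `YBSquareSLE`, with `Φ = id`.** If hexagonal endpoint approximations exist (item 9864,
proved) and Glazman–Manolescu's critical `π/2` walk converges to chordal SLE(8/3) (stmt-6967), then the YB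
shear transport statement of line `pin-the-shear` holds with the identity matrix: under (A) both the `π/2`
law in `D` and the hexagonal law in `D` (along a hexagonal endpoint approximation of `D`) converge to
SLE(8/3) random curves of `D`, equal in law, so their integrals against every bounded continuous test
function have difference tending to `0`. [folklore] -/
theorem ybShearTransport_of_ybSquareSLE : (∀ (D : DobrushinDomain) (a b : ℝ → Site 2), SAW.IsEndpointApprox D a b → ∃ a' b' : ℝ → HexVertex, SAW.IsEmbEndpointApprox hexGraph hexCenter D a' b') → SAWCompassLattice.YBSquareSLE → SAWDevelopingMap.HexConjecture → ∃ m₁₁ m₁₂ m₂₁ m₂₂ : ℝ, 0 < m₁₁ * m₂₂ - m₁₂ * m₂₁ ∧ ∀ Φ : ℂ ≃ₜ ℂ, (∀ z : ℂ, Φ z = ((m₁₁ * z.re + m₁₂ * z.im : ℝ) : ℂ) + ((m₂₁ * z.re + m₂₂ * z.im : ℝ) : ℂ) * Complex.I) → ∀ (D : DobrushinDomain) (a b : ℝ → MidEdge), IsYBEndpointApprox (fun (_ : ℤ) => Real.pi / 2) D a b → ∃ a' b' : ℝ → HexVertex, SAW.IsEmbEndpointApprox hexGraph hexCenter (D.map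 Φ.symm) a' b' ∧ ∀ f : BoundedContinuousFunction (CurveClass ℂ) ℝ, Tendsto (fun δ => (∫ γ, f (γ.curve (fun (_ : ℤ) => Real.pi / 2) δ) ∂(ybLaw (fun (_ : ℤ) => Real.pi / 2) D.carrier δ 1 (a δ) (b δ))) - ∫ γ, f (CurveClass.map (Φ : C(ℂ, ℂ)) γ.curve) ∂(SAW.hexSAWLaw (D.map Φ.symm).carrier δ (a' δ) (b' δ))) (𝓝[>] 0) (𝓝 0) := by
  intro hE hY hA
  refine ⟨1, 0, 0, 1, by norm_num, ?_⟩
  intro Φ hΦ D a b hab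
  -- `Φ` is the identity
  have hΦid : Φ = Homeomorph.refl ℂ := by
    ext1 z
    rw [hΦ z, Homeomorph.refl_apply]
    apply Complex.ext <;> simp
  subst hΦid
  rw [Homeomorph.refl_symm, MarkedDomain.map_refl, CurveClass.map_homeomorph_refl]
  -- hexagonal endpoints of `D` (from any `δℤ²` endpoint approximation, which exists) and the two limits
  obtain ⟨a₀, b₀, h₀⟩ := SAW.exists_isEndpointApprox D
  obtain ⟨a', b', hab'⟩ := hE D a₀ b₀ h₀
  refine ⟨a', b', hab', fun f => ?_⟩
  obtain ⟨Γ, hΓ, -, hT⟩ := hY D a b hab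
  obtain ⟨Γ', hΓ', -, hT'⟩ := hA D a' b' hab'
  have hint : ∫ ω, f (Γ ω) ∂Literature.Probability.Process.preWienerMeasure =
      ∫ ω, f (Γ' ω) ∂Literature.Probability.Process.preWienerMeasure := by
    rw [← integral_map hΓ.1 f.continuous.aestronglyMeasurable,
      ← integral_map hΓ'.1 f.continuous.aestronglyMeasurable, IsSLECurve.map_eq_holds hΓ hΓ']
  have h := (hT f).sub (hT' f)
  rwa [hint, sub_self] at h

end Summit.CriticalPhenomena.SAWScalingLimit.Cruxes.HexTransfer.Sandwich

end
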